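import Literature.Computability.Complexity.StackModArith
import HarnessLib

/-!
# Verified arithmetic on stack programs: multiplication by an outer register (Horner)

Trunk `CplxCore`, toolkit continuing `StackArith.lean` (bank `AReg`, `add`, `normalize`) in the
"operand in an outer register, most significant bit first" style of `StackModArith.lean` /
`StackGcd.lean` / `StackDiv.lean` (`κ ⊕ AReg`, bank programs embedded by `bk = Com.map Sum.inr`):

* `Com.mulStep b`, `Com.mulOf m` — **multiplication by Horner's rule** (Knuth's Algorithm M in
  radix 2, left to right): for the bits of the outer register `m` (multiplier, most
  significant bit first, consumed), `x := 2x + bit · y`; from `x = 0` this leaves `x = y · m`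
  (`runs_mulOf`, model `mulOfRes`, value `bitsToNat_mulOfRes`), all results normalised;
Cost quadratic (`|m| · O(A + |m|)` under `⟦x⟧ + ⟦y⟧ < 2^A`). Division with quotient is `StackDiv.lean`
(`divOf`). Served (forthcoming): the signed multiply–accumulate of `StackIntsMul.lean` and the LLL
machine (fact `Literature.Algebra.EuclideanLattices.lllReduce_polyTime`); usable by any `FP` proof needing plain
(non-modular) multiplication.

## References

* D. E. Knuth, *The Art of Computer Programming*, Vol. 2, 3rd ed., Addison-Wesley 1998, §4.3.1,
  Algorithm M (multiplication), here in radix 2 and left to right. (Not held; schoolbook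
  algorithm, fully proved here.)
* T. Nipkow, G. Klein, *Concrete Semantics with Isabelle/HOL*, Springer 2014, Ch. 7.
-/

namespace Literature.Computability.Complexity

open _root_.Computability AReg

namespace Com

/-! ### One Horner step: `x := 2x + b·y` -/

/-- `mulStep b`: on the bank, `x := 2x + b · y`, normalised (`s t f` must be empty).
[Knuth 1998, §4.3.1, Algorithm M] [folklore] -/
def mulStep : Bool → Com AReg
  | true => push .x false ;; add ;; normalize
  | false => push .x false ;; normalize

/-- Model of `mulStep`. [folklore] -/
def mulStepRes (b : Bool) (acc n : List Bool) : List Bool :=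
  bif b then norm (addRes (false :: acc) n) else norm (false :: acc)

/-- **Value of `mulStep`**: `2·acc + b·n`. [Knuth 1998, §4.3.1, Algorithm M] [folklore] -/
theorem bitsToNat_mulStepRes (b : Bool) (acc n : List Bool) :
    bitsToNat (mulStepRes b acc n) = 2 * bitsToNat acc + b.toNat * bitsToNat n := by
  cases b <;> simp [mulStepRes, bitsToNat_addRes]

/-- The result of `mulStep` is normal. [folklore] -/
theorem norm_mulStepRes (b : Bool) (acc n : List Bool) : norm (mulStepRes b acc n) = mulStepRes b acc n := by
  cases b <;> simp [mulStepRes, norm_eq_encodeNat]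

/-- Length of the result of `mulStep`: the size of its value. [folklore] -/
theorem length_mulStepRes (b : Bool) (acc n : List Bool) :
    (mulStepRes b acc n).length = (2 * bitsToNat acc + b.toNat * bitsToNat n).size := by
  rw [← bitsToNat_mulStepRes, ← length_norm, norm_mulStepRes]

/-- **Simulation of `mulStep`**, in `22(|x| + |y|) + 50` steps. [Knuth 1998, §4.3.1, Algorithm M] [folklore] -/
theorem runs_mulStep (b : Bool) (acc n z u g : List Bool) :
    Runs (mulStep b) (file acc n z [] [] u [] g) (file (mulStepRes b acc n) n z [] [] u [] g)
      (22 * (acc.length + n.length) + 50) := by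
  have h1 : Runs (push .x false) (file acc n z [] [] u [] g) (file (false :: acc) n z [] [] u [] g) 1 :=
    Runs.push' (by simp)
  cases b
  · have h2 := runs_normalize (false :: acc) n z [] u g
    refine (h1.seq h2).of_eq (by simp [mulStepRes]) ?_
    simp; omega
  · have h2 := runs_add (false :: acc) n z u g
    have h3 := runs_normalize (addRes (false :: acc) n) n z [] u g
    have hl := length_addRes_le (false :: acc) n
    refine (h1.seq (h2.seq h3)).of_eq (by simp [mulStepRes]) ?_
    simp only [List.length_cons] at hl ⊢; omega

/-! ### Multiplication by an outer register (most significant bit first) -/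

section Embedded

variable {κ : Type} [DecidableEq κ]

/-- `mulOf m`: **multiplication by Horner's rule**: for the bits of the outer register `m`
(the multiplier, *most significant bit first*, consumed): `x := 2x + bit · y`; from `x = 0`
this leaves `x = y · m`. [Knuth 1998, §4.3.1, Algorithm M] [folklore] -/
def mulOf (m : κ) : Com (κ ⊕ AReg) := loop (Sum.inl m) (bk (mulStep true)) (bk (mulStep false))

/-- Model of `mulOf`. [folklore] -/
def mulOfRes : List Bool → List Bool → List Bool → List Bool
  | [], acc, _ => acc
  | b :: bs, acc, n => mulOfRes bs (mulStepRes b acc n) n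

/-- **Value of `mulOf`** (the multiplier read most significant bit first):
`acc · 2^|bs| + n · ⟦bs.reverse⟧`. [Knuth 1998, §4.3.1, Algorithm M] [folklore] -/
theorem bitsToNat_mulOfRes : ∀ (bs acc n : List Bool),
    bitsToNat (mulOfRes bs acc n) = bitsToNat acc * 2 ^ bs.length + bitsToNat n * bitsToNat bs.reverse
  | [], acc, n => by simp [mulOfRes]
  | b :: bs, acc, n => by
    rw [mulOfRes, bitsToNat_mulOfRes bs, bitsToNat_mulStepRes, List.reverse_cons, bitsToNat_append,
      List.length_reverse, List.length_cons, bitsToNat_cons, bitsToNat_nil, pow_succ]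
    cases b <;> simp <;> ring

/-- `mulOf` keeps a normal accumulator normal (any multiplier). [folklore] -/
theorem norm_mulOfRes : ∀ (bs acc n : List Bool), norm acc = acc → norm (mulOfRes bs acc n) = mulOfRes bs acc n
  | [], _, _, h => h
  | b :: bs, acc, n, _ => norm_mulOfRes bs _ n (norm_mulStepRes b acc n)

/-- Growth invariant of the Horner loop: `⟦acc⟧ + ⟦n⟧` at most doubles per step. [folklore] -/
theorem mulStepRes_add_lt (b : Bool) (acc n : List Bool) {A : ℕ} (h : bitsToNat acc + bitsToNat n < 2 ^ A) :
    bitsToNat (mulStepRes b acc n) + bitsToNat n < 2 ^ (A + 1) := by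
  rw [bitsToNat_mulStepRes, pow_succ]
  have hb : b.toNat ≤ 1 := Bool.toNat_le b
  nlinarith

/-- Hence the length of every intermediate result is controlled. [folklore] -/
theorem length_mulStepRes_le (b : Bool) (acc n : List Bool) {A : ℕ} (h : bitsToNat acc + bitsToNat n < 2 ^ A) :
    (mulStepRes b acc n).length ≤ A + 1 := by
  rw [length_mulStepRes, Nat.size_le]
  have := mulStepRes_add_lt b acc n h
  rw [bitsToNat_mulStepRes] at this
  omega

/-- **Simulation of `mulOf`**: with `T m = bs`, `x = acc`, `y = n`, `⟦acc⟧ + ⟦n⟧ < 2^A`,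
`|acc| ≤ A`, `|n| ≤ A`, the loop empties `m` and leaves `mulOfRes bs acc n` in `x`, within
`|bs| · (44 (A + |bs|) + 52) + 1` steps. [Knuth 1998, §4.3.1, Algorithm M] [folklore] -/
theorem runs_mulOf (m : κ) : ∀ (bs : List Bool) (T : Regs κ) (acc n zz uu gg : List Bool) (A : ℕ),
    T m = bs → bitsToNat acc + bitsToNat n < 2 ^ A → acc.length ≤ A → n.length ≤ A →
      Runs (mulOf m) (Sum.elim T (file acc n zz [] [] uu [] gg))
        (Sum.elim (Function.update T m []) (file (mulOfRes bs acc n) n zz [] [] uu [] gg))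
        (bs.length * (44 * (A + bs.length) + 52) + 1)
  | [], T, acc, n, zz, uu, gg, A, hT, _, _, _ => by
    refine (Runs.loop_nil _ _ (by simp [hT])).of_eq ?_ (by simp)
    rw [mulOfRes, ← hT, Function.update_eq_self]
  | b :: bs, T, acc, n, zz, uu, gg, A, hT, h, hacc, hn => by
    have hk : (Sum.elim T (file acc n zz [] [] uu [] gg) : Regs (κ ⊕ AReg)) (Sum.inl m) = b :: bs := by
      simp [hT]
    have hbody : ∀ b' : Bool, Runs (bk (mulStep b') : Com (κ ⊕ AReg))
        (Function.update (Sum.elim T (file acc n zz [] [] uu [] gg)) (Sum.inl m) bs)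
        (Sum.elim (Function.update T m bs) (file (mulStepRes b' acc n) n zz [] [] uu [] gg))
        (44 * A + 50) := fun b' => by
      rw [Sum.update_elim_inl]
      exact ((runs_mulStep b' acc n zz uu gg).inr _).of_eq rfl (by nlinarith [hacc, hn])
    have hrest := runs_mulOf m bs (Function.update T m bs) (mulStepRes b acc n) n zz uu gg (A + 1)
      (by simp) (mulStepRes_add_lt b acc n h) (length_mulStepRes_le b acc n h) (by omega)
    rw [Function.update_idem] at hrest
    have hcost : 44 * A + 50 + 2 + (bs.length * (44 * (A + 1 + bs.length) + 52) + 1) ≤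
        (b :: bs).length * (44 * (A + (b :: bs).length) + 52) + 1 := by
      have e : (b :: bs).length * (44 * (A + (b :: bs).length) + 52) =
          bs.length * (44 * (A + 1 + bs.length) + 52) + (44 * (A + 1 + bs.length) + 52) := by
        simp only [List.length_cons]; ring
      rw [e]; omega
    cases b
    · exact (Runs.loop_false hk (hbody false) hrest).of_eq rfl hcost
    · exact (Runs.loop_true hk (hbody true) hrest).of_eq rfl hcost

/-- **`mulOf` from zero computes the product** `y · m` (the multiplier read most significant
bit first). [Knuth 1998, §4.3.1, Algorithm M] [folklore] -/
theorem bitsToNat_mulOfRes_nil (bs n : List Bool) :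
    bitsToNat (mulOfRes bs [] n) = bitsToNat n * bitsToNat bs.reverse := by
  rw [bitsToNat_mulOfRes]; simp

/-- From zero the product is a canonical numeral. [folklore] -/
theorem mulOfRes_nil_eq_encodeNat (bs n : List Bool) :
    mulOfRes bs [] n = encodeNat (bitsToNat n * bitsToNat bs.reverse) := by
  rw [← bitsToNat_mulOfRes_nil, ← norm_eq_encodeNat]
  exact (norm_mulOfRes bs [] n norm_nil).symm

end Embedded

end Com

end Literature.Computability.Complexity
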